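import Summits.CriticalPhenomena.SAWScalingLimit.Theorems.SAWTotalPositivityCriticalBubbleBoundKestenMSCanonUpArch
import Summits.CriticalPhenomena.SAWScalingLimit.Theorems.SAWTotalPositivityCriticalBubbleBoundKestenMSUpArchBridge
import Summits.CriticalPhenomena.SAWScalingLimit.Theorems.SAWTotalPositivityCriticalBubbleBoundKestenMSBridgeMass
import Summits.CriticalPhenomena.SAWScalingLimit.Theorems.SAWTotalPositivityCriticalBubbleBoundKestenHWColumnRenewal
import Mathlib.Analysis.PSeries
import Literature.Probability.LatticeModels.FKIsingRSWSecondMoment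
import HarnessLib

/-!
# Madras–Slade Corollary 8.1.5 for `ℤ²`: `Σ_N h_N q_N x_c^N ≤ C Σ_N h_N N^{-1/2}` and its consequences
(line `kesten-product-renewal-dictionary`, crux `SAWTotalPositivity.CriticalBubbleBound`, stmt-CriticalPhenomena-7117;
lead c5 — the TARGET `ms_polygon_antitone` of the c5 programme "MS §8.1 for `ℤ²`", `α_sing ≤ 3/2`)

`q_N = isotropicPolygonCount N` is the number of `N`-step self-avoiding polygons of `ℤ²` up to translation and
`x_c = 1/μ`; the crux is the finiteness of `polygonSeries = Σ_N N q_N x_c^N` (landed normal form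
`Negative.criticalBubbleBound_iff_polygonSeries_ne_top`). This file proves, for every NON-INCREASING
`h : ℕ → [0,∞]`,

  `Σ_N h(N) q_N x_c^N ≤ 2√2 μ · Σ_m h(m) (m+1)^{-1/2}`            (`ms_polygon_antitone`, MS Cor. 8.1.5),

by the chain `q_N ≤ #canonSet N` (`Negative.isotropicPolygonCount_le_card_canonSet`) `≤ #{up-first arches}`
(`MS.ms_canon_le_upArch`) `≤ #{N-step bridges with transversal displacement 1}` (`MS.ms_upArch_le_pinnedBridges`,
MS Prop. 8.1.2) `↪` self-avoiding bridge WORDS with `wEnd w 1 = 1` (`wordOf`), and MS Prop. 8.1.4 in the word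
model (`MS.ms_pinnedBridgeMass_antitone`: Kesten's factorisation + anti-concentration of the transversal
coordinate of the renewal walk). Consequences — the first POLYNOMIAL restrictive estimates on the crux's series
in the tree (its proved window was stretched-exponential, `Negative.hw_term_upper_bound`):

* `ms_polygon_partialSum_le` — `Σ_{N ≤ M} q_N x_c^N ≤ 4√2 μ √(M+1)` (MS Cor. 8.1.6(b), `d = 2`: "`θ ≥ 1/2` on
  average"; termwise bounds alone would give `O(M)`);
* `ms_polygon_term_le` — `q_N x_c^N ≤ 4√2 μ √(N+1)` (one term of the partial sum; TERMWISE this is weaker than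
  Hammersley's classical `q_N ≤ μ^N` from polygon concatenation and than Madras 1995's `q_N ≤ C N^{-1/2} μ^N` from
  polygon joining — neither is in the tree and neither is attempted here; the content of this file is the
  AVERAGED exponent);
* `ms_polygonSeries_partialSum_le` — `Σ_{N ≤ M} N q_N x_c^N ≤ 4√2 μ (M+1)^{3/2}` (the crux asks `O(1)`; termwise
  bounds alone would give `O(M²)`);
* `ms_polygon_rpow_series_ne_top` — `Σ_N (N+1)^{-s} q_N x_c^N < ∞` for every `s > 1/2` (the unrooted mass
  `𝒫 = Σ q_N x_c^N` is the case `s = 0`, the crux `T` the case `s = -1`; both stay open).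

Sources: N. Madras, G. Slade, *The Self-Avoiding Walk* (1993), §8.1, Prop. 8.1.2, Prop. 8.1.4, Cor. 8.1.5,
Cor. 8.1.6; N. Madras (1991), *Bounds on the critical exponent of self-avoiding polygons*.
-/

noncomputable section

open Literature.Probability.LatticeModels
open Literature.Probability.RandomPlanarGeometry Literature.Probability.RandomPlanarGeometry.SAW
open Summit.CriticalPhenomena.SAWScalingLimit.Theorems.CriticalBubbleBound.Negative
open Summit.CriticalPhenomena.SAWScalingLimit.Theorems.CriticalBubbleBound.Kesten
open Literature.Barriers.CriticalPhenomena (isotropicPolygonCount)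
open scoped ENNReal NNReal BigOperators
open Classical

namespace Summit.CriticalPhenomena.SAWScalingLimit.Theorems.CriticalBubbleBound.Kesten.MS

/-! ## Polygons are fewer than transversally pinned bridges (MS Prop. 8.1.2, counting form) -/

/-- `q_N ≤ #{N-step bridges ζ with ζ(N)₂ = 1}` for every `N` (for `N = 0` both sides vanish or `q_0 = 0`).
[cite: MadrasSlade1993, Proposition 8.1.2] -/
theorem ms815_polygon_le_pinnedBridge (N : ℕ) :
    isotropicPolygonCount N ≤ ((Zd.bridges 2 N).filter (fun ζ => ζ N 1 = 1)).card := by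
  rcases Nat.eq_zero_or_pos N with rfl | hN
  · rw [isotropicPolygonCount_zero]; exact Nat.zero_le _
  · calc isotropicPolygonCount N ≤ (canonSet N).card := isotropicPolygonCount_le_card_canonSet N
      _ ≤ ((Zd.sawFun 2 (N - 1) e₀).filter (fun ω => ω 1 = eUp ∧ ∀ j ≤ N - 1, 0 ≤ ω j 1)).card :=
          ms_canon_le_upArch N
      _ ≤ ((Zd.bridges 2 (N - 1 + 1)).filter (fun ζ => ζ (N - 1 + 1) 1 = 1)).card :=
          ms_upArch_le_pinnedBridges (N - 1)
      _ = _ := by rw [Nat.sub_add_cancel hN]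

/-! ## Transfer of the pinned bridge counts to the word model -/

/-- The word of a vertex-function bridge with transversal displacement `1` is a self-avoiding bridge word with
`wEnd w 1 = 1`. [folklore] -/
theorem ms815_wordOf_spec {N : ℕ} {ζ : ℕ → Site 2}
    (hζ : ζ ∈ (Zd.bridges 2 N).filter (fun ζ => ζ N 1 = 1)) :
    IsSAW (wordOf N ζ) ∧ IsBridgeW (wordOf N ζ) ∧ wEnd (wordOf N ζ) 1 = 1 := by
  rw [Finset.mem_filter] at hζ
  obtain ⟨hb, h1⟩ := hζ
  obtain ⟨hs, hbw, -⟩ := HW.wordOf_fn_spec hb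
  refine ⟨hs, hbw, ?_⟩
  rw [← traj_length, length_wordOf, traj_wordOf (Zd.mem_bridges.1 hb).1, h1]

/-- For every weight `h`, `Σ_N h(N) · #{pinned N-step bridges} · x_c^N ≤ Σ_{w SAW bridge word, wEnd w 1 = 1}
h(|w|) x_c^{|w|}` (the map `ζ ↦ wordOf N ζ` is injective). [folklore] -/
theorem ms815_pinnedBridge_transfer (h : ℕ → ℝ≥0∞) :
    (∑' N : ℕ, h N * ((((Zd.bridges 2 N).filter (fun ζ => ζ N 1 = 1)).card : ℕ) : ℝ≥0∞) *
        ENNReal.ofReal (criticalFugacity ^ N)) ≤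
      ∑' w : {w : List Step // IsSAW w ∧ IsBridgeW w ∧ wEnd w 1 = 1},
        h w.1.length * ENNReal.ofReal (criticalFugacity ^ w.1.length) := by
  -- the sigma type of pinned bridges of all lengths, and its injection into the words
  let B : ℕ → Finset (ℕ → Site 2) := fun N => (Zd.bridges 2 N).filter (fun ζ => ζ N 1 = 1)
  let G : {w : List Step // IsSAW w ∧ IsBridgeW w ∧ wEnd w 1 = 1} → ℝ≥0∞ :=
    fun w => h w.1.length * ENNReal.ofReal (criticalFugacity ^ w.1.length)
  let ι : (Σ N : ℕ, {ζ // ζ ∈ B N}) → {w : List Step // IsSAW w ∧ IsBridgeW w ∧ wEnd w 1 = 1} :=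
    fun x => ⟨wordOf x.1 x.2.1, ms815_wordOf_spec x.2.2⟩
  have hι : Function.Injective ι := by
    rintro ⟨N, ζ, hζ⟩ ⟨N', ζ', hζ'⟩ hx
    have hw : wordOf N ζ = wordOf N' ζ' := congrArg Subtype.val hx
    have hN : N = N' := by
      have := congrArg List.length hw
      rwa [length_wordOf, length_wordOf] at this
    subst hN
    have hζb := (Zd.mem_bridges.1 (Finset.mem_filter.1 hζ).1).1
    have hζb' := (Zd.mem_bridges.1 (Finset.mem_filter.1 hζ').1).1
    have : ζ = ζ' := by rw [← traj_wordOf hζb, hw, traj_wordOf hζb']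
    subst this
    rfl
  calc (∑' N : ℕ, h N * (((B N).card : ℕ) : ℝ≥0∞) * ENNReal.ofReal (criticalFugacity ^ N))
      = ∑' N : ℕ, ∑ _ζ ∈ B N, h N * ENNReal.ofReal (criticalFugacity ^ N) := by
        refine tsum_congr fun N => ?_
        rw [Finset.sum_const, nsmul_eq_mul]
        ring
    _ = ∑' N : ℕ, ∑' ζ : {ζ // ζ ∈ B N}, G (ι ⟨N, ζ⟩) := by
        refine tsum_congr fun N => ?_
        have hG : ∀ ζ : {ζ // ζ ∈ B N}, G (ι ⟨N, ζ⟩) = h N * ENNReal.ofReal (criticalFugacity ^ N) := by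
          intro ζ
          show h (wordOf N ζ.1).length * ENNReal.ofReal (criticalFugacity ^ (wordOf N ζ.1).length) = _
          rw [length_wordOf]
        rw [tsum_congr hG]
        exact (Finset.tsum_subtype (B N) (fun _ => h N * ENNReal.ofReal (criticalFugacity ^ N))).symm
    _ = ∑' x : (Σ N : ℕ, {ζ // ζ ∈ B N}), G (ι x) :=
        (ENNReal.tsum_sigma' (fun x : (Σ N : ℕ, {ζ // ζ ∈ B N}) => G (ι x))).symm
    _ ≤ ∑' w, G w := ENNReal.tsum_comp_le_tsum_of_injective hι G

/-! ## Corollary 8.1.5 -/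

/-- **MS Corollary 8.1.5 for `ℤ²`** (target `ms_polygon_antitone` of the c5 programme): for every
non-increasing `h : ℕ → [0,∞]`, `Σ_N h(N) q_N x_c^N ≤ 2√2 μ · Σ_m h(m) (m+1)^{-1/2}`.
[cite: MadrasSlade1993, Corollary 8.1.5] -/
theorem ms_polygon_antitone : ∀ (h : ℕ → ℝ≥0∞), Antitone h → (∑' N : ℕ, h N * (isotropicPolygonCount N : ℝ≥0∞) * ENNReal.ofReal (criticalFugacity ^ N)) ≤ ENNReal.ofReal (2 * Real.sqrt 2 * connectiveConstant) * ∑' m : ℕ, h m * ENNReal.ofReal (1 / Real.sqrt ((m : ℝ) + 1)) := by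
  intro h hh
  have hx := StripMass.criticalFugacity_pos
  calc (∑' N : ℕ, h N * (isotropicPolygonCount N : ℝ≥0∞) * ENNReal.ofReal (criticalFugacity ^ N))
      ≤ ∑' N : ℕ, h N * ((((Zd.bridges 2 N).filter (fun ζ => ζ N 1 = 1)).card : ℕ) : ℝ≥0∞) *
          ENNReal.ofReal (criticalFugacity ^ N) := by
        refine ENNReal.tsum_le_tsum fun N => ?_
        gcongr
        exact_mod_cast ms815_polygon_le_pinnedBridge N
    _ ≤ _ := ms815_pinnedBridge_transfer h
    _ ≤ ENNReal.ofReal (Real.sqrt 2 / criticalFugacity) *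
          ∑' m : ℕ, h m * ENNReal.ofReal (1 / Real.sqrt ((m : ℝ) + 1)) := ms_pinnedBridgeMass_antitone h hh 1
    _ ≤ _ := by
        refine mul_le_mul' (ENNReal.ofReal_le_ofReal ?_) le_rfl
        rw [show Real.sqrt 2 / criticalFugacity = Real.sqrt 2 * connectiveConstant by
          rw [criticalFugacity, div_inv_eq_mul]]
        have hμ : 0 < connectiveConstant := by
          have := hx; rwa [criticalFugacity, inv_pos] at this
        nlinarith [Real.sqrt_nonneg 2, mul_nonneg (Real.sqrt_nonneg 2) hμ.le]

/-! ## Consequences: partial sums, terms, weighted series -/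

/-- **Partial sums** (MS Cor. 8.1.6(b), `d = 2`): `Σ_{N ≤ M} q_N x_c^N ≤ 4√2 μ √(M+1)`.
[cite: MadrasSlade1993, Corollary 8.1.6] -/
theorem ms_polygon_partialSum_le (M : ℕ) :
    ∑ N ∈ Finset.range (M + 1), (isotropicPolygonCount N : ℝ) * criticalFugacity ^ N ≤
      4 * Real.sqrt 2 * connectiveConstant * Real.sqrt ((M : ℝ) + 1) := by
  have hx := StripMass.criticalFugacity_pos
  have hμ : 0 < connectiveConstant := by have := hx; rwa [criticalFugacity, inv_pos] at this
  -- the indicator weight of `[0, M]`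
  let h : ℕ → ℝ≥0∞ := fun N => if N ≤ M then 1 else 0
  have hh : Antitone h := by
    intro a b hab
    show (if b ≤ M then (1 : ℝ≥0∞) else 0) ≤ if a ≤ M then 1 else 0
    by_cases hb : b ≤ M
    · rw [if_pos hb, if_pos (hab.trans hb)]
    · rw [if_neg hb]; exact zero_le
  have main := ms_polygon_antitone h hh
  -- left side: the finite sum
  have hL : ENNReal.ofReal (∑ N ∈ Finset.range (M + 1), (isotropicPolygonCount N : ℝ) * criticalFugacity ^ N) ≤
      ∑' N : ℕ, h N * (isotropicPolygonCount N : ℝ≥0∞) * ENNReal.ofReal (criticalFugacity ^ N) := by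
    rw [ENNReal.ofReal_sum_of_nonneg (fun N _ => by positivity)]
    calc ∑ N ∈ Finset.range (M + 1), ENNReal.ofReal ((isotropicPolygonCount N : ℝ) * criticalFugacity ^ N)
        = ∑ N ∈ Finset.range (M + 1), h N * (isotropicPolygonCount N : ℝ≥0∞) *
            ENNReal.ofReal (criticalFugacity ^ N) := by
          refine Finset.sum_congr rfl fun N hN => ?_
          rw [Finset.mem_range] at hN
          rw [show h N = 1 from if_pos (by omega), one_mul, ENNReal.ofReal_mul (by positivity),
            ENNReal.ofReal_natCast]
      _ ≤ _ := ENNReal.sum_le_tsum _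
  -- right side: the finite sum of `1/√(m+1)`
  have hR : (∑' m : ℕ, h m * ENNReal.ofReal (1 / Real.sqrt ((m : ℝ) + 1))) ≤
      ENNReal.ofReal (2 * Real.sqrt ((M : ℝ) + 1)) := by
    rw [show (∑' m : ℕ, h m * ENNReal.ofReal (1 / Real.sqrt ((m : ℝ) + 1))) =
        ∑ m ∈ Finset.range (M + 1), h m * ENNReal.ofReal (1 / Real.sqrt ((m : ℝ) + 1)) from
      tsum_eq_sum fun m hm => by
        rw [Finset.mem_range] at hm
        rw [show h m = 0 from if_neg (by omega), zero_mul]]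
    calc ∑ m ∈ Finset.range (M + 1), h m * ENNReal.ofReal (1 / Real.sqrt ((m : ℝ) + 1))
        = ∑ m ∈ Finset.range (M + 1), ENNReal.ofReal (1 / Real.sqrt ((m : ℝ) + 1)) := by
          refine Finset.sum_congr rfl fun m hm => ?_
          rw [Finset.mem_range] at hm
          rw [show h m = 1 from if_pos (by omega), one_mul]
      _ = ENNReal.ofReal (∑ m ∈ Finset.range (M + 1), 1 / Real.sqrt ((m : ℝ) + 1)) :=
          (ENNReal.ofReal_sum_of_nonneg (fun m _ => by positivity)).symm
      _ ≤ _ := ENNReal.ofReal_le_ofReal (Literature.Probability.LatticeModels.sum_range_one_div_sqrt_le M)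
  have h3 := (hL.trans main).trans (mul_le_mul' le_rfl hR)
  rw [← ENNReal.ofReal_mul (by positivity)] at h3
  have := (ENNReal.ofReal_le_ofReal_iff (by positivity)).1 h3
  nlinarith [this, Real.sqrt_nonneg ((M : ℝ) + 1), Real.sqrt_nonneg 2]

/-- **Terms**: `q_N x_c^N ≤ 4√2 μ √(N+1)` (one term of the partial sum; termwise weaker than Hammersley's
classical `q_N ≤ μ^N`, which the tree does not have — recorded only as the tree's first polynomial termwise
bound). [cite: MadrasSlade1993, Corollary 8.1.6] -/
theorem ms_polygon_term_le (N : ℕ) :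
    (isotropicPolygonCount N : ℝ) * criticalFugacity ^ N ≤
      4 * Real.sqrt 2 * connectiveConstant * Real.sqrt ((N : ℝ) + 1) := by
  refine le_trans ?_ (ms_polygon_partialSum_le N)
  have h0 : ∀ i ∈ Finset.range (N + 1), 0 ≤ (isotropicPolygonCount i : ℝ) * criticalFugacity ^ i :=
    fun i _ => by have := StripMass.criticalFugacity_pos; positivity
  exact Finset.single_le_sum h0 (Finset.self_mem_range_succ N)

/-- **Partial sums of the crux's own series**: `Σ_{N ≤ M} N q_N x_c^N ≤ 4√2 μ (M+1)^{3/2}` (the crux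
`CriticalBubbleBound` is the statement that these partial sums are bounded). [cite: MadrasSlade1993, Corollary 8.1.6] -/
theorem ms_polygonSeries_partialSum_le (M : ℕ) :
    ∑ N ∈ Finset.range (M + 1), (N : ℝ) * (isotropicPolygonCount N : ℝ) * criticalFugacity ^ N ≤
      4 * Real.sqrt 2 * connectiveConstant * (((M : ℝ) + 1) * Real.sqrt ((M : ℝ) + 1)) := by
  have hx := StripMass.criticalFugacity_pos
  calc ∑ N ∈ Finset.range (M + 1), (N : ℝ) * (isotropicPolygonCount N : ℝ) * criticalFugacity ^ N
      ≤ ∑ N ∈ Finset.range (M + 1), ((M : ℝ) + 1) * ((isotropicPolygonCount N : ℝ) * criticalFugacity ^ N) := by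
        refine Finset.sum_le_sum fun N hN => ?_
        rw [Finset.mem_range] at hN
        rw [mul_assoc]
        gcongr
        exact_mod_cast (by omega : N ≤ M + 1)
    _ = ((M : ℝ) + 1) * ∑ N ∈ Finset.range (M + 1), (isotropicPolygonCount N : ℝ) * criticalFugacity ^ N := by
        rw [Finset.mul_sum]
    _ ≤ ((M : ℝ) + 1) * (4 * Real.sqrt 2 * connectiveConstant * Real.sqrt ((M : ℝ) + 1)) := by
        gcongr; exact ms_polygon_partialSum_le M
    _ = _ := by ring

/-- **The rung `-1/2⁻` of the moment ladder is finite**: `Σ_N (N+1)^{-s} q_N x_c^N < ∞` for every `s > 1/2`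
(MS Cor. 8.1.5 with `h_N = (N+1)^{-s}`: the comparison series `Σ (N+1)^{-s-1/2}` converges). The unrooted
mass `𝒫` (`s = 0`) and the crux `T` (`s = -1`) stay open. [cite: MadrasSlade1993, Corollary 8.1.5] -/
theorem ms_polygon_rpow_series_ne_top {s : ℝ} (hs : 1 / 2 < s) :
    (∑' N : ℕ, ENNReal.ofReal (((N : ℝ) + 1) ^ (-s)) * (isotropicPolygonCount N : ℝ≥0∞) *
        ENNReal.ofReal (criticalFugacity ^ N)) ≠ ⊤ := by
  let h : ℕ → ℝ≥0∞ := fun N => ENNReal.ofReal (((N : ℝ) + 1) ^ (-s))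
  have hh : Antitone h := by
    intro a b hab
    refine ENNReal.ofReal_le_ofReal ?_
    exact Real.rpow_le_rpow_of_nonpos (by positivity) (by exact_mod_cast Nat.add_le_add_right hab 1)
      (by linarith)
  refine ne_top_of_le_ne_top ?_ (ms_polygon_antitone h hh)
  refine ENNReal.mul_ne_top ENNReal.ofReal_ne_top ?_
  -- `Σ (m+1)^{-s} (m+1)^{-1/2} = Σ (m+1)^{-(s + 1/2)} < ∞`
  have hterm : ∀ m : ℕ, h m * ENNReal.ofReal (1 / Real.sqrt ((m : ℝ) + 1)) =
      ENNReal.ofReal (((m : ℝ) + 1) ^ (-(s + 1 / 2))) := by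
    intro m
    have hm : (0 : ℝ) < (m : ℝ) + 1 := by positivity
    show ENNReal.ofReal (((m : ℝ) + 1) ^ (-s)) * ENNReal.ofReal (1 / Real.sqrt ((m : ℝ) + 1)) = _
    rw [← ENNReal.ofReal_mul (Real.rpow_nonneg hm.le _), Real.sqrt_eq_rpow, one_div,
      ← Real.rpow_neg hm.le, ← Real.rpow_add hm]
    congr 2
    ring
  rw [tsum_congr hterm]
  have hsum : Summable fun m : ℕ => ((m : ℝ) + 1) ^ (-(s + 1 / 2)) := by
    have h1 : Summable fun n : ℕ => ((n : ℝ)) ^ (-(s + 1 / 2)) := Real.summable_nat_rpow.2 (by linarith)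
    simpa using (summable_nat_add_iff 1).2 h1
  rw [← ENNReal.ofReal_tsum_of_nonneg (fun m => Real.rpow_nonneg (by positivity) _) hsum]
  exact ENNReal.ofReal_ne_top

end Summit.CriticalPhenomena.SAWScalingLimit.Theorems.CriticalBubbleBound.Kesten.MS

end
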